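import Mathlib.Algebra.Homology.HomologySequenceLemmas
import HarnessLib

/-!
# The homology sequence: two-out-of-three for the middle term

Weibel, *An Introduction to Homological Algebra*, Thm. 1.3.1 (the long exact homology sequence of
a short exact sequence of complexes, natural by Prop. 1.3.4) with Ex. 1.3.3 (the 5-lemma and its
mono / epi halves, the two 4-lemmas): given a morphism `φ : S₁ ⟶ S₂` of short exact sequences
`0 → X₁ → X₂ → X₃ → 0` of complexes in an abelian category, if two of `φ.τ₁`, `φ.τ₂`, `φ.τ₃` are
quasi-isomorphisms, so is the third. Mathlib (`Mathlib/Algebra/Homology/HomologySequenceLemmas.lean`)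
proves the case where `φ.τ₃` is the unknown (`HomologicalComplex.HomologySequence.quasiIso_τ₃`) and
records the other two as a TODO; the tree's `Literature/Algebra/Homology/HomologySequenceTauOne.lean`
supplies `φ.τ₁` (`Literature.Algebra.Homology.quasiIso_τ₁`, Mayer–Vietoris ladders). This file
supplies the MIDDLE term, in the same generality (any abelian category, any complex shape) and by
the same method (the exact six-term pieces `composableArrows₅` of the long exact sequence, their
naturality `mapComposableArrows₅`, and the 4-lemmas of `CategoryTheory.Abelian.DiagramLemmas.Four`;
degrees without predecessor / successor by the 3-lemmas and
`mono/epi_homologyMap_of_…_of_not_rel`):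

* `mono_homologyMap_τ₂`, `epi_homologyMap_τ₂`, `isIso_homologyMap_τ₂` — degreewise criteria;
* **`quasiIso_τ₂`** — `φ.τ₁`, `φ.τ₃` quasi-isomorphisms ⇒ `φ.τ₂` quasi-isomorphism;
* `isIso_homologyMap_τ₂_of_forall` — the all-degrees `IsIso` form.

This is the shape of the dévissage steps along exact sequences whose OUTER terms are already
compared (e.g. extensions of vector bundles `0 → 𝓐 → 𝓑 → 𝓒 → 0` in Serre's GAGA n° 13, or the
conormal / Euler ladders), used by `Literature/Algebra/Homology/OrderedCechShortExactComparison.lean`.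
Related (not importable here — Literature never imports Summits): the venture file
`Summits/Ventures/HSemireg/HomComplexExact.lean` carries its own copy `Summit.Ventures.HSemireg.quasiIso_τ₂`
of the middle-term lemma for its Hom-complex induction; the present file is its Literature home.
Theorems only; no definitions, no named facts.

## References
* [Weibel1994] C. A. Weibel, *An Introduction to Homological Algebra* (1994), Thm. 1.3.1,
  Ex. 1.3.3 (5-lemma), Prop. 1.3.4.
-/

open CategoryTheory CategoryTheory.Limits ComposableArrows Abelian HomologicalComplex
  HomologicalComplex.HomologySequence

namespace Literature.Algebra.Homology

variable {C ι : Type*} [Category C] [Abelian C] {c : ComplexShape ι}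
  {S₁ S₂ : ShortComplex (HomologicalComplex C c)} (φ : S₁ ⟶ S₂)
  (hS₁ : S₁.ShortExact) (hS₂ : S₂.ShortExact)

include hS₁ hS₂

/-- **4-lemma, mono half, for the middle term**: `H_j(φ.τ₂)` is a monomorphism as soon as
`H_i(φ.τ₃)` is epi in the preceding degree `i` (if any) and `H_j(φ.τ₁)`, `H_j(φ.τ₃)` are mono (the
window `H_i X₃ → H_j X₁ → H_j X₂ → H_j X₃`). [cite: Weibel1994, Thm. 1.3.1 and Ex. 1.3.3] -/
theorem mono_homologyMap_τ₂ (j : ι)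
    (h₁ : ∀ i, c.Rel i j → Epi (homologyMap φ.τ₃ i))
    (h₂ : Mono (homologyMap φ.τ₁ j))
    (h₃ : Mono (homologyMap φ.τ₃ j)) :
    Mono (homologyMap φ.τ₂ j) := by
  by_cases hj : ∃ i, c.Rel i j
  · obtain ⟨i, hij⟩ := hj
    haveI := h₁ i hij
    exact mono_of_epi_of_mono_of_mono'' (by omega : 2 + 3 ≤ 5) (composableArrows₅_exact hS₁ i j hij)
      (composableArrows₅_exact hS₂ i j hij) (mapComposableArrows₅ φ hS₁ hS₂ i j hij) 2 3 4 5 rfl rfl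
      rfl rfl (h₁ i hij) h₂ h₃
  · have hj' : ∀ i, ¬ c.Rel i j := fun i hi => hj ⟨i, hi⟩
    have := hS₂.mono_f
    have hm := HomologicalComplex.mono_homologyMap_of_mono_of_not_rel S₂.f j hj'
    exact mono_of_mono_of_mono_of_mono (mapComposableArrows₂ φ j) (composableArrows₂_exact hS₁ j)
      hm h₂ h₃

/-- **4-lemma, epi half, for the middle term**: `H_i(φ.τ₂)` is an epimorphism as soon as
`H_i(φ.τ₁)`, `H_i(φ.τ₃)` are epi and `H_j(φ.τ₁)` is mono in the following degree `j` (if any) (the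
window `H_i X₁ → H_i X₂ → H_i X₃ → H_j X₁`). [cite: Weibel1994, Thm. 1.3.1 and Ex. 1.3.3] -/
theorem epi_homologyMap_τ₂ (i : ι)
    (h₁ : Epi (homologyMap φ.τ₁ i))
    (h₂ : Epi (homologyMap φ.τ₃ i))
    (h₃ : ∀ j, c.Rel i j → Mono (homologyMap φ.τ₁ j)) :
    Epi (homologyMap φ.τ₂ i) := by
  by_cases hi : ∃ j, c.Rel i j
  · obtain ⟨j, hij⟩ := hi
    haveI := h₃ j hij
    exact epi_of_epi_of_epi_of_mono'' (by omega : 0 + 3 ≤ 5) (composableArrows₅_exact hS₁ i j hij)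
      (composableArrows₅_exact hS₂ i j hij) (mapComposableArrows₅ φ hS₁ hS₂ i j hij) 0 1 2 3 rfl rfl
      rfl rfl h₁ h₂ (h₃ j hij)
  · have hi' : ∀ j, ¬ c.Rel i j := fun j hj => hi ⟨j, hj⟩
    have := hS₁.epi_g
    have he := HomologicalComplex.epi_homologyMap_of_epi_of_not_rel S₁.g i hi'
    exact epi_of_epi_of_epi_of_epi (mapComposableArrows₂ φ i) (composableArrows₂_exact hS₂ i) he h₁
      h₂

/-- `H_i(φ.τ₂)` is an isomorphism from the neighbouring hypotheses (the 5-lemma on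
`H_{i'} X₃ → H_i X₁ → H_i X₂ → H_i X₃ → H_j X₁`). [cite: Weibel1994, Thm. 1.3.1 and Ex. 1.3.3] -/
theorem isIso_homologyMap_τ₂ (i : ι)
    (h₁ : ∀ i', c.Rel i' i → Epi (homologyMap φ.τ₃ i'))
    (h₂ : IsIso (homologyMap φ.τ₁ i))
    (h₃ : IsIso (homologyMap φ.τ₃ i))
    (h₄ : ∀ j, c.Rel i j → Mono (homologyMap φ.τ₁ j)) :
    IsIso (homologyMap φ.τ₂ i) := by
  have := mono_homologyMap_τ₂ φ hS₁ hS₂ i h₁ inferInstance inferInstance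
  have := epi_homologyMap_τ₂ φ hS₁ hS₂ i inferInstance inferInstance h₄
  exact isIso_of_mono_of_epi _

/-- **Two out of three, middle term**: if `φ.τ₁` and `φ.τ₃` are quasi-isomorphisms, so is `φ.τ₂`.
[cite: Weibel1994, Thm. 1.3.1 and Ex. 1.3.3] -/
theorem quasiIso_τ₂ (h₁ : QuasiIso φ.τ₁) (h₃ : QuasiIso φ.τ₃) : QuasiIso φ.τ₂ := by
  rw [quasiIso_iff]
  intro i
  rw [quasiIsoAt_iff_isIso_homologyMap]
  apply isIso_homologyMap_τ₂ φ hS₁ hS₂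
  all_goals intros; infer_instance

/-- The all-degrees `IsIso` form: if `H•(φ.τ₁)` and `H•(φ.τ₃)` are isomorphisms in every degree, so
is `H•(φ.τ₂)`. [cite: Weibel1994, Thm. 1.3.1 and Ex. 1.3.3] -/
theorem isIso_homologyMap_τ₂_of_forall (h₁ : ∀ i, IsIso (homologyMap φ.τ₁ i))
    (h₃ : ∀ i, IsIso (homologyMap φ.τ₃ i)) (i : ι) : IsIso (homologyMap φ.τ₂ i) := by
  apply isIso_homologyMap_τ₂ φ hS₁ hS₂ i _ (h₁ i) (h₃ i)
  · intro j _; haveI := h₁ j; infer_instance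
  · intro i' _; haveI := h₃ i'; infer_instance

end Literature.Algebra.Homology
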